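import Summits.BirchSwinnertonDyer.BirchSwinnertonDyer.Theorems.KolyvaginRoadThreeRationalLiftFirstFloorAt
import Summits.BirchSwinnertonDyer.BirchSwinnertonDyer.Theorems.KolyvaginRoadThreeTowerFormPrintFree
import Literature.NumberTheory.EllipticCurves.HeegnerPointsKolyvaginSelmerProofs
import HarnessLib

/-!
# Route `KolyvaginRoadThree`, deciding crux `ZhangSharpFrameAtThreeHL` (item stmt-BirchSwinnertonDyer-19574): the REGISTERED TEXT of
# stub S1 `stub_bottomRankOneAtThree` (line v3.1) from «the definite first floor at ONE killing good unipotent-admissible prime per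
# frame» — the ∃-cut of S1 offered to the planner (owner's ∀-cut: `kolyvaginClass_one_ne_zero_of_definiteFirstFloor`, koly g16)
# (cell `bsd-stepL`, seat `bsd-stepL-koly3b` g7 (PART 1b ACCEL seat (10)); `--supports stmt-BirchSwinnertonDyer-19574`, helper)

WHAT. `stub_bottomRankOneAtThree_of_firstFloorAtKillingPrime (H) : <text of stub_bottomRankOneAtThree VERBATIM>` where `H` asks, at every
Hoffstein–Luo A1 frame with `dim_𝔽₃ Sel₃(E/K) = 1` and for every complex conjugation `c ≠ 1`, ONE good unipotent-admissible prime `q` (place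
`v`) that KILLS `Sel₃(E/K)` (some Selmer class has `loc_v ≠ 0`) together with the three first-floor bricks AT THAT `q`: (DLR)
`DefiniteLevelRaisingAt W K q`, (J′) `JochnowitzAtThree W K Dt β ι q`, (V′) `DefiniteUnitValueAtThree W K c q` (owner's typed defs,
`…Method2DefiniteFirstFloorDefs`). Proof: the sibling `bottomRankOne_at_frame_of_definiteFirstFloor_at` (p542519: `SelQ {q} ± = ⊥` at ANY
killing good `q`, W. Zhang Prop 5.4 at a given prime, no Poitou–Tate) + the print-free conductor-1 datum
(`Theorems.nonempty_kolyvaginHeegnerData_one_printFree`, koly g15) + a complex conjugation (`exists_conj_of_isImaginaryQuadratic`).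
WHY ∃: killing good primes have positive density (stub A's (Cheb), LANDED), so the bricks may be asked at a CHOSEN one — e.g. on koly g16's
conductor-exactly-`N` PIN locus where (DLR) with the anemic pin is the right statement, or at a `q` carrying a RATIONAL raised newform, where
(V′)'s Selmer half is the sibling's `selmerGroup_eq_bot_of_rationalLift_of_kill` (p541025) and only (J′) + the `L`-value half remain modular.

HONEST FRAMING. One theorem (no definition, no named fact, no `sorry`); S1 is NOT proved — (DLR), (J′), (V′) at the chosen prime stay
hypotheses (W. Zhang Thm 2.1 ∕ 3.1 ∕ 7.1 at `p = 3`, not in print); nothing is booked; this seat does not reshape the registered line (the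
owner ∕ planner decide). PARTITION: O2@3 (B10) × A1 × crux 19574 × stub S1 — proves-glue (∃-cut); closes: none (T7).
bears_on: KOLY (route-BirchSwinnertonDyer-KolyvaginRoadThree, 19574 deciding).

References: [cite: WZhang2014, Thm. 7.2 (proof), Prop. 5.4, §9] [cite: BertoliniDarmon2005, Thm. 9.2] [cite: GrossLMS1991, §3, §5].
-/

noncomputable section

open scoped Classical

namespace Summit.BirchSwinnertonDyer.Rank1Residual.X11b.Three.Koly.RationalLift

open WeierstrassCurve NumberField IsDedekindDomain CategoryTheory
  Literature.NumberTheory.EllipticCurves Literature.NumberTheory.EllipticCurves.ModularForms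
  Literature.NumberTheory.GaloisRepresentations Module
open Summit.BirchSwinnertonDyer.Rank1Residual.X11b.Three.Koly.Method2
open Summit.BirchSwinnertonDyer.Rank1Residual.X11b.Three.Koly.Method2DefiniteFirstFloor

/-- **Stub S1 (`stub_bottomRankOneAtThree`, registered text of line v3.1, VERBATIM as conclusion) from the definite first floor at ONE
killing good unipotent-admissible prime per frame.** The hypothesis `H`: at every Hoffstein–Luo A1 frame of the crux with
`dim_𝔽₃ Sel₃(E/K) = 1`, for every `c : K ≃ₐ[ℚ] K`, `c ≠ 1`, there are a good unipotent-admissible `q`, its place `v`, a Selmer class with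
non-zero localisation at `v`, and (DLR) ∧ (J′) ∧ (V′) at `q`. CONDITIONAL on `H`; the conductor-1 datum and the complex conjugation are
supplied print-free. [cite: WZhang2014, Thm. 7.2, Prop. 5.4] [cite: GrossLMS1991, §3] -/
theorem stub_bottomRankOneAtThree_of_firstFloorAtKillingPrime
    (H : ∀ (W : WeierstrassCurve ℚ) [W.IsElliptic] [W.IsGloballyMinimal] [NeZero (W.conductorNorm ℤ)] (K : Type)
      [Field K] [NumberField K] (Dt : ModularParametrizationData W (W.conductorNorm ℤ)) (β : ℤ) (ι : K →+* ℂ),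
      Summit.BirchSwinnertonDyer.Rank1Residual.ClassX11b W 3 → W.HasMultiplicativeReductionAtPrime 3 →
      Rank1Residual.Surj W 3 → Rank1Residual.Ram W 3 → ¬ 3 ∣ W.tamagawaProduct → IsImaginaryQuadratic K →
      Odd (NumberField.discr K) → SatisfiesHeegnerHypothesis (W.conductorNorm ℤ) K →
      (W.quadraticTwist (NumberField.discr K : ℚ)).entireLFunction 1 ≠ 0 → NumberField.discr K ≠ -3 →
      (4 * (W.conductorNorm ℤ : ℤ)) ∣ β ^ 2 - NumberField.discr K → ¬ (3 : ℤ) ∣ Dt.c →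
      ∀ (c : K ≃ₐ[ℚ] K), c ≠ 1 → ∀ [Module (ZMod 3) (V3 W K)],
      finrank (ZMod 3)
        (AddSubgroup.toZModSubmodule 3 (selmerGroup (W.baseChange K) ((3 ^ 1 : ℕ) : ℤ))) = 1 →
      ∃ (q : {q // IsUAdmissiblePrime W K q}) (v : HeightOneSpectrum (𝓞 K)),
        FrobSqNeOneAt W 3 q.1 ∧ ((q : ℕ) : 𝓞 K) ∈ v.asIdeal ∧
        (∃ s ∈ selmerGroup (W.baseChange K) ((3 ^ 1 : ℕ) : ℤ),
          (W.baseChange K).torsionLocMap (v.adicCompletion K) ((3 ^ 1 : ℕ) : ℤ) s ≠ 0) ∧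
        DefiniteLevelRaisingAt W K q ∧ JochnowitzAtThree W K Dt β ι q ∧ DefiniteUnitValueAtThree W K c q) :
    ∀ (W : WeierstrassCurve ℚ) [W.IsElliptic] [W.IsGloballyMinimal] [NeZero (W.conductorNorm ℤ)] (K : Type)
      [Field K] [NumberField K] (Dt : ModularParametrizationData W (W.conductorNorm ℤ)) (β : ℤ) (ι : K →+* ℂ),
      Summit.BirchSwinnertonDyer.Rank1Residual.ClassX11b W 3 → W.HasMultiplicativeReductionAtPrime 3 →
      Rank1Residual.Surj W 3 → Rank1Residual.Ram W 3 → ¬ 3 ∣ W.tamagawaProduct → IsImaginaryQuadratic K →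
      Odd (NumberField.discr K) → SatisfiesHeegnerHypothesis (W.conductorNorm ℤ) K →
      (W.quadraticTwist (NumberField.discr K : ℚ)).entireLFunction 1 ≠ 0 → NumberField.discr K ≠ -3 →
      (4 * (W.conductorNorm ℤ : ℤ)) ∣ β ^ 2 - NumberField.discr K → ¬ (3 : ℤ) ∣ Dt.c →
      ∀ [Module (ZMod 3) (V3 W K)],
      finrank (ZMod 3)
        (AddSubgroup.toZModSubmodule 3 (selmerGroup (W.baseChange K) ((3 ^ 1 : ℕ) : ℤ))) = 1 →
      ∃ d : KolyvaginHeegnerData Dt β ι 1, d.kolyvaginClass Nat.prime_three 1 ≠ 0 := by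
  intro W _ _ _ K _ _ Dt β ι hX hmult hsurj hram htam hK hodd hH hLt h3 hβ hc _ hone
  obtain ⟨c, hc1, -⟩ := exists_conj_of_isImaginaryQuadratic K hK
  obtain ⟨q, v, hq, hv, hkill, hDLR, hJ, hV⟩ := H W K Dt β ι hX hmult hsurj hram htam hK hodd hH hLt h3 hβ hc c hc1 hone
  exact bottomRankOne_at_frame_of_definiteFirstFloor_at W K hK c Dt β ι hone q hq v hv hkill hDLR hJ hV
    (Summit.BirchSwinnertonDyer.BirchSwinnertonDyer.Theorems.nonempty_kolyvaginHeegnerData_one_printFree W K Dt β ι hK hH hβ)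

end Summit.BirchSwinnertonDyer.Rank1Residual.X11b.Three.Koly.RationalLift

end
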